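import Summits.BirchSwinnertonDyer.BirchSwinnertonDyer.Theorems.ErratumRoadFiveIMCDivTransferUnrReceptacle
import HarnessLib

/-!
# K2 crux 19270 `IMCDivAtErratumDataAll` (H3♭), ROAD FF — the glue at the tree's receptacle with
# ONE-SIDED Σ-removal on the Selmer side (`Ch(X^∅)·(P_Σ) ⊆ Ch(X^Σ)`, no surjectivity of localisation)

Cell `bsd-stepL`, seat `bsd-stepL-imc-p1` (g7). `--supports stmt-BirchSwinnertonDyer-19270 --as helper`.
HONEST FRAMING: BSD is not proved for any pair by this file; it closes no item; no definition, no
named fact, no `sorry`. Sequel of p470728 ∕ p474991 ∕ p475740 ∕ p476122 ∕ p476656.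

The Σ-removal input F7 was so far consumed as an EQUALITY `Ch_Λ(X^Σ_ac) = Ch_Λ(X^∅_ac)·(P_Σ)`
([JSW17, proof of Thm. 6.1.6], which needs the SURJECTIVITY of the localisation map, Prop. 3.3.2,
under (corank 1) ∕ (sur)). The transfer only needs the INJECTIVE half: from
`0 → Sel^∅ → Sel^Σ → ⊕_{w ∈ Σ} H¹(K_w, M)/H¹_f` one gets `X^Σ ↠ X^∅` with kernel a quotient of the
local duals, hence `Ch(X^∅)·∏_{w∈Σ} P_w ⊆ Ch(X^Σ)` with no surjectivity input (imc24c's observation,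
p471038 §2, for the tree object). This file records the bookkeeping lemma with the one-sided
hypothesis (`CongruenceLimit.map_le_span_of_transfer_of_imprimitive_le`) and the final crux-level end
form at the tree's receptacle `ℤ_p⟦T⟧ → R₀⟦T⟧ → 𝓞_{ℂ_p}⟦T⟧` with it
(`XAc.map_charIdeal_le_span_of_roadFF_unr_le`: divisible invariants, torsion only, one-sided Σ) —
the weakest set of Road-FF hypotheses in this series.

References: [Castella2018Erratum] Lemma 2.1, Thm. 2.3, proof of Thm. 1.1 (p. 4); [Castella2018]
§3 (p. 9), (3.1), Thm. 3.1; [Skinner2016PacificMC] §3.1; [JetchevSkinnerWan2017] §3.3 (the exact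
sequence defining the Σ-imprimitive Selmer group), Thm. 6.1.6; [GreenbergVatsal2000] Prop. 2.4.
-/

noncomputable section

open scoped TensorProduct
open Literature.RingTheory.FittingIdeal Literature.NumberTheory.EllipticCurves
  Literature.NumberTheory.EllipticCurves.Module

namespace Summit.BirchSwinnertonDyer.Rank1Residual.X11b.CongruenceLimit

/-- **Σ-removal and receptacle bookkeeping, ONE-SIDED Selmer input.** As
`map_le_span_of_transfer_of_imprimitive` (p470728 §3) but with `hSig : C^∅·(P_Σ) ⊆ C^Σ` (the
injective half of the Σ-change, no surjectivity of localisation) in place of the equality.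
[cite: JetchevSkinnerWan2017, §3.3 (definition of the Σ-imprimitive Selmer group) and Thm. 6.1.6 (proof)]
[cite: Castella2018, (3.1) (definition of the Σ-imprimitive L-function)] -/
theorem map_le_span_of_transfer_of_imprimitive_le
    {Λ R S T : Type*} [CommRing Λ] [CommRing R] [CommRing S] [IsDomain S] [CommRing T]
    (i : Λ →+* R) (φ : R →+* S) (j : S →+* T)
    {CS C0 : Ideal Λ} {PS : Λ} (hSig : C0 * Ideal.span {PS} ≤ CS) (hP : φ (i PS) ≠ 0)
    {𝔠 : Ideal R} (hSh : CS.map i ≤ 𝔠)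
    {LS L : S} (h𝔠 : 𝔠.map φ ≤ Ideal.span {LS})
    (hLS : Ideal.span {LS} = Ideal.span {φ (i PS) * L})
    {Q : T} (hQ : Ideal.span {j L} = Ideal.span {Q}) :
    C0.map (j.comp (φ.comp i)) ≤ Ideal.span {Q} := by
  -- `C^∅·(P_Σ)·S ⊆ C^Σ·S ⊆ (L^Σ) = (P_Σ · L)`
  have h1 : ((C0 * Ideal.span {PS}).map i).map φ ≤ Ideal.span {φ (i PS) * L} :=
    hLS ▸ ((Ideal.map_mono (Ideal.map_mono hSig)).trans ((Ideal.map_mono hSh).trans h𝔠))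
  have h2 : ((C0 * Ideal.span {PS}).map i).map φ =
      (C0.map (φ.comp i)) * Ideal.span {φ (i PS)} := by
    rw [Ideal.map_map, Ideal.map_mul, Ideal.map_span, Set.image_singleton, RingHom.comp_apply]
  have h3 : C0.map (φ.comp i) ≤ Ideal.span {L} := by
    rw [h2, mul_comm (φ (i PS)) L, ← Ideal.span_singleton_mul_span_singleton] at h1
    exact (Ideal.span_singleton_mul_left_mono hP).mp h1
  have h4 : (C0.map (φ.comp i)).map j ≤ Ideal.span {j L} := by
    refine (Ideal.map_mono h3).trans (le_of_eq ?_)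
    rw [Ideal.map_span, Set.image_singleton]
  rw [← Ideal.map_map]
  exact h4.trans (le_of_eq hQ)

end Summit.BirchSwinnertonDyer.Rank1Residual.X11b.CongruenceLimit

namespace Summit.BirchSwinnertonDyer.Rank1Residual.X11b.AcSelmer.XAc

open CategoryTheory Literature.NumberTheory.GaloisRepresentations IsLocalRing NumberField
  IsDedekindDomain Field TorsionControl PowerSeries
  Summit.BirchSwinnertonDyer.Rank1Residual.X11b.Halves
  Summit.BirchSwinnertonDyer.Rank1Residual.X2.HidaLimitAlgebra
open scoped ContRepresentation

/-- **ROAD FF, KERNEL GLUE AT THE TREE's RECEPTACLE, weakest hypotheses of the series** (twin of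
`map_charIdeal_le_span_of_roadFF_unr`, p476656, with the ONE-SIDED Σ-input
`hSig : Ch_Λ(X^∅_ac)·(P_Σ) ⊆ Ch_Λ(X^Σ_ac)`). For ANY
`W/K`, `κ`, `𝔭`, `Σ`, `γ`: from D1 ∕ D2 (`ρf`, `ρg m` over `Λ = ℤ_p⟦T⟧`, `p`-divisible, with
`p^m`-divisible global and constrained-local invariants = F5 in `selmerTorsionEquiv`'s shape),
F2 (`θ m : M_{g_m}[p^m] ≅ M_f[p^m]`), finite generation of the dual Selmer groups, F1
(`hSh : Ch_Λ(X^Σ_ac(E[p^∞])) ⊆ Ch_Λ(Sel^Σ(M_f)^∨)`), F7 (`Ch(X^∅_ac)·(P_Σ) ⊆ Ch(X^Σ_ac)` — injective half only —,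
`P_Σ ≠ 0` in `R₀⟦T⟧`, `(L^Σ_f) = (P_Σ·L_f)` in `R₀⟦T⟧`), F4 (`hCh m : Ch_Λ(Sel(M_{g_m})^∨)·R₀⟦T⟧ ⊆
(L_m)` when torsion — [FW21, Thm. 4.41] for the crystalline `g_m`), F3 (`hc m : (L_m) + (p^m) =
(L^Σ_f) + (p^m)` in `R₀⟦T⟧` — [Cas20, Thm. 2.11]) and torsionness of `X_f`: the crux conjunct
`Ch_Λ(X^∅_ac)·𝓞_{ℂ_p}⟦T⟧ ⊆ (Q)` for every `Q` generating `(L_f)` in `𝓞_{ℂ_p}⟦T⟧`. The receptacle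
hypotheses of p476122 §4 are DISCHARGED here: `R₀` is a DVR (X2), `(p) ⊆ Jac(R₀⟦T⟧)` (X2),
`toUnr` injective (`X11b.toUnr_injective`), `unrToCpInt ∘ toUnr = toCpInt` (R1). No erratum Lemma 2.2. CONDITIONAL on its
hypotheses only; closes nothing; BSD proved for no pair.
[cite: Castella2018Erratum, Thm. 1.1 ⇐ Thm. 2.3, proof p. 4, read one-sidedly, Lemma 2.2 bypassed]
[cite: Castella2018, §3 (p. 9) (the receptacle R₀), (3.1) and Thm. 3.1]
[cite: Skinner2016PacificMC, §3.1 (p. 192)] [cite: JetchevSkinnerWan2017, Prop. 3.3.2 and Thm. 6.1.6 (proof)] -/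
theorem map_charIdeal_le_span_of_roadFF_unr_le
    {K : Type} [Field K] [NumberField K] (W : WeierstrassCurve K) (p : ℕ) [Fact p.Prime]
    (κ : ZpExtension K p) (𝔭 : HeightOneSpectrum (𝓞 K)) (Sg : Set (HeightOneSpectrum (𝓞 K)))
    (γ : absoluteGaloisGroup K) [Fact (κ.IsTopGenerator γ)]
    [TopologicalSpace (IwasawaAlgebra p)]
    -- Galois side over `Λ = ℤ_p⟦T⟧`
    {Γ₀ : Type} [Group Γ₀] [TopologicalSpace Γ₀] [IsTopologicalGroup Γ₀]
    {ι₀ : Type*} {Γw : ι₀ → Type} [∀ v, Group (Γw v)] [∀ v, TopologicalSpace (Γw v)]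
    [∀ v, IsTopologicalGroup (Γw v)] (ψ : ∀ v, Γw v →ₜ* Γ₀) (L₀ : Set ι₀)
    {Mf : Type} [AddCommGroup Mf] [Module (IwasawaAlgebra p) Mf] [TopologicalSpace Mf]
    [DiscreteTopology Mf] [ContinuousSMul (IwasawaAlgebra p) Mf]
    (ρf : ContinuousRep Γ₀ (IwasawaAlgebra p) Mf)
    (hdivf : Function.Surjective fun x : Mf => (C (p : ℤ_[p]) : IwasawaAlgebra p) • x)
    (hglobf : ∀ m, 1 ≤ m → ∀ w ∈ ρf.toTopRep.ρ.invariants,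
      ∃ w' ∈ ρf.toTopRep.ρ.invariants, (C (p : ℤ_[p]) : IwasawaAlgebra p) ^ m • w' = w)
    (hlocf : ∀ m, 1 ≤ m → ∀ v ∈ L₀, ∀ w ∈ ((ρf.restrict (ψ v)).toTopRep).ρ.invariants,
      ∃ w' ∈ ((ρf.restrict (ψ v)).toTopRep).ρ.invariants,
        (C (p : ℤ_[p]) : IwasawaAlgebra p) ^ m • w' = w)
    (Mg : ℕ → Type) [∀ m, AddCommGroup (Mg m)] [∀ m, Module (IwasawaAlgebra p) (Mg m)]
    [∀ m, TopologicalSpace (Mg m)] [∀ m, DiscreteTopology (Mg m)]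
    [∀ m, ContinuousSMul (IwasawaAlgebra p) (Mg m)]
    (ρg : ∀ m, ContinuousRep Γ₀ (IwasawaAlgebra p) (Mg m))
    (hdivg : ∀ m, 1 ≤ m → Function.Surjective fun x : Mg m => (C (p : ℤ_[p]) : IwasawaAlgebra p) • x)
    (hglobg : ∀ m, 1 ≤ m → ∀ w ∈ (ρg m).toTopRep.ρ.invariants,
      ∃ w' ∈ (ρg m).toTopRep.ρ.invariants, (C (p : ℤ_[p]) : IwasawaAlgebra p) ^ m • w' = w)
    (hlocg : ∀ m, 1 ≤ m → ∀ v ∈ L₀, ∀ w ∈ (((ρg m).restrict (ψ v)).toTopRep).ρ.invariants,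
      ∃ w' ∈ (((ρg m).restrict (ψ v)).toTopRep).ρ.invariants,
        (C (p : ℤ_[p]) : IwasawaAlgebra p) ^ m • w' = w)
    (θ : ∀ m, 1 ≤ m → ((torsionRep (ρg m) ((C (p : ℤ_[p]) : IwasawaAlgebra p) ^ m)).toTopRep ≅
      (torsionRep ρf ((C (p : ℤ_[p]) : IwasawaAlgebra p) ^ m)).toTopRep))
    [Module.Finite (IwasawaAlgebra p) (CharacterModule (selmer ψ L₀ ρf))]
    [∀ m, Module.Finite (IwasawaAlgebra p) (CharacterModule (selmer ψ L₀ (ρg m)))]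
    -- F1 (Shapiro, inequality direction) and F7 (Σ-removal)
    (hSh : XAc.charIdeal W p κ 𝔭 Sg γ ≤
      Literature.NumberTheory.EllipticCurves.Module.charIdeal (IwasawaAlgebra p)
        (CharacterModule (selmer ψ L₀ ρf)))
    {PS : IwasawaAlgebra p}
    (hSig : XAc.charIdeal W p κ 𝔭 ∅ γ * Ideal.span {PS} ≤ XAc.charIdeal W p κ 𝔭 Sg γ)
    (hP : PowerSeries.map (toUnr p) PS ≠ 0)
    {LS Lf : UnrSeries p}
    (hLS : Ideal.span {LS} = Ideal.span {PowerSeries.map (toUnr p) PS * Lf})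
    -- F4 and F3 in `R₀⟦T⟧`, torsionness of `X_f`
    (Lg : ℕ → UnrSeries p)
    (hCh : ∀ m, 1 ≤ m →
      Module.IsTorsion (IwasawaAlgebra p) (CharacterModule (selmer ψ L₀ (ρg m))) →
      (Literature.NumberTheory.EllipticCurves.Module.charIdeal (IwasawaAlgebra p)
        (CharacterModule (selmer ψ L₀ (ρg m)))).map (PowerSeries.map (toUnr p)) ≤
          Ideal.span {Lg m})
    (hc : ∀ m, 1 ≤ m →
      Ideal.span {Lg m} ⊔ (Ideal.span {(C (p : unrIntegers p) : UnrSeries p)}) ^ m =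
        Ideal.span {LS} ⊔ (Ideal.span {(C (p : unrIntegers p) : UnrSeries p)}) ^ m)
    (hT : Module.IsTorsion (IwasawaAlgebra p) (CharacterModule (selmer ψ L₀ ρf)))
    -- the frame in the final receptacle
    {Q : PowerSeries 𝓞_ℂ_[p]}
    (hQ : Ideal.span {PowerSeries.map (R1.unrToCpInt p) Lf} = Ideal.span {Q}) :
    (XAc.charIdeal W p κ 𝔭 ∅ γ).map (PowerSeries.map (R1.toCpInt p)) ≤ Ideal.span {Q} := by
  letI : Algebra ℤ_[p] (unrIntegers p) := (toUnr p).toAlgebra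
  haveI := isDiscreteValuationRing_unrIntegers (p := p)
  have halg : algebraMap (IwasawaAlgebra p) (UnrSeries p) = PowerSeries.map (toUnr p) := rfl
  have hι : Function.Injective (algebraMap ℤ_[p] (unrIntegers p)) := X11b.toUnr_injective
  have hmapC : (Ideal.span {(C (p : ℤ_[p]) : IwasawaAlgebra p)}).map
      (algebraMap (IwasawaAlgebra p) (UnrSeries p)) =
      Ideal.span {(C (p : unrIntegers p) : UnrSeries p)} := by
    rw [halg, Ideal.map_span, Set.image_singleton, map_C, map_natCast]
  have ha : (Ideal.span {(C (p : ℤ_[p]) : IwasawaAlgebra p)}).map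
      (algebraMap (IwasawaAlgebra p) (UnrSeries p)) ≤ (⊥ : Ideal (UnrSeries p)).jacobson := by
    rw [hmapC]
    exact span_C_p_le_jacobson_unrSeries
  have hcomp : (PowerSeries.map (R1.unrToCpInt p)).comp
      ((algebraMap (IwasawaAlgebra p) (UnrSeries p)).comp (RingHom.id (IwasawaAlgebra p))) =
      PowerSeries.map (R1.toCpInt p) := by
    rw [RingHom.comp_id, halg, ← PowerSeries.map_comp, R1.unrToCpInt_comp_toUnr]
  have hSh' : (XAc.charIdeal W p κ 𝔭 Sg γ).map (RingHom.id (IwasawaAlgebra p)) ≤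
      Literature.NumberTheory.EllipticCurves.Module.charIdeal (IwasawaAlgebra p)
        (CharacterModule (selmer ψ L₀ ρf)) := by
    rw [Ideal.map_id]
    exact hSh
  have hP' : algebraMap (IwasawaAlgebra p) (UnrSeries p) (RingHom.id (IwasawaAlgebra p) PS) ≠ 0 := by
    rw [RingHom.id_apply, halg]
    exact hP
  have hLS' : Ideal.span {LS} =
      Ideal.span {algebraMap (IwasawaAlgebra p) (UnrSeries p) (RingHom.id (IwasawaAlgebra p) PS) *
        Lf} := by
    rw [RingHom.id_apply, halg]
    exact hLS
  have hCh' : ∀ m, 1 ≤ m →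
      Module.IsTorsion (IwasawaAlgebra p) (CharacterModule (selmer ψ L₀ (ρg m))) →
      (Literature.NumberTheory.EllipticCurves.Module.charIdeal (IwasawaAlgebra p)
        (CharacterModule (selmer ψ L₀ (ρg m)))).map
          (algebraMap (IwasawaAlgebra p) (UnrSeries p)) ≤ Ideal.span {Lg m} := by
    intro m hm ht
    rw [halg]
    exact hCh m hm ht
  have hc' : ∀ m, 1 ≤ m →
      Ideal.span {Lg m} ⊔ ((Ideal.span {(C (p : ℤ_[p]) : IwasawaAlgebra p)}).map
        (algebraMap (IwasawaAlgebra p) (UnrSeries p))) ^ m =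
      Ideal.span {LS} ⊔ ((Ideal.span {(C (p : ℤ_[p]) : IwasawaAlgebra p)}).map
        (algebraMap (IwasawaAlgebra p) (UnrSeries p))) ^ m := by
    intro m hm
    rw [hmapC]
    exact hc m hm
  have h𝔠 := map_charIdeal_le_span_of_selmer_congruences_divisible ψ L₀ hι
    (C (p : ℤ_[p]) : IwasawaAlgebra p) ρf hdivf hglobf hlocf Mg ρg hdivg hglobg hlocg θ ha Lg hCh'
    hc' hT
  rw [← hcomp]
  exact CongruenceLimit.map_le_span_of_transfer_of_imprimitive_le (RingHom.id (IwasawaAlgebra p))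
    (algebraMap (IwasawaAlgebra p) (UnrSeries p)) (PowerSeries.map (R1.unrToCpInt p)) hSig hP' hSh'
    h𝔠 hLS' hQ

end Summit.BirchSwinnertonDyer.Rank1Residual.X11b.AcSelmer.XAc

end
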